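import Literature.AlgebraicGeometry.HodgeTheory.AlgebraicityLocusLinearSections
import HarnessLib

/-!
# The locus of parameters whose fibre support has dimension `≥ k` is Zariski closed

Topic `Literature/AlgebraicGeometry/HodgeTheory` (family `hodge`). Theorems only (no definition, no
named fact; D-0026).

Setting (as in `AlgebraicityLocusLinearSections`, section `Family`): a proper family `f : 𝒳 ⟶ S` of
`ℂ`-schemes, a parameter `ℂ`-scheme `hT : T ⟶ S` (e.g. the parameter space `((ℙ^{N_d})^*)^m × S` of
the hyperplane witness families `hyperplaneFamily f ε d m`, `AlgebraicityLocusWitnesses`), a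
preimmersion `ε : 𝒳 ⟶ ℙᴺ`, and a closed family of supports `𝒵 ⊆ 𝒳 × T` whose slice
`𝒵_y = {x | (x, y) ∈ 𝒵}` over every complex point `y` of `T` lies in the fibre `𝒳_{hT(y)}`.

The proof of the tree's `codim_dichotomy_of_isPreimmersion` builds an OPEN subset `O ⊆ T` whose
complex points are exactly those `y` whose slice satisfies the codimension condition "every point `x`
of `𝒵_y` has `height x + p ≤ n`" (equivalently `dim 𝒵_y < n + 1 - p`, by the projective dimension
theorem `forall_height_lt_iff_exists_forms`: the slice misses `ε⁻¹ V₊(F₁, …, F_k)` for SOME linear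
forms, and for fixed forms this is the complement of the image of a closed set under the proper
projection `𝒳 ×_S T → T`). That theorem then only keeps the generic dichotomy on irreducible subsets.
This file records the locus itself:

* `exists_opens_pt_mem_iff_forall_height_add_le` — the open `O` with
  `y ∈ O(ℂ) ↔ ∀ x ∈ 𝒵_y, height x + p ≤ n` (the construction of `codim_dichotomy_of_isPreimmersion`,
  verbatim);
* `exists_isClosed_pt_mem_iff_exists_lt_height_add` — its complement, a CLOSED `C ⊆ T` with
  `y ∈ C(ℂ) ↔ ∃ x ∈ 𝒵_y, n < height x + p` (Chevalley's upper semicontinuity of the fibre dimension,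
  EGA IV₃ 13.1.5, in the form the tree can carry: `dim closure {x} = height x`);
* `exists_isClosed_pt_mem_iff_exists_height_ne_zero` — the case `p = n`: **the parameters whose
  support is positive-dimensional (contains a non-closed point of its fibre) form a Zariski-closed
  subset of `T`** — the substitute, on the tree's Hilbert-scheme-free witness families, for "the
  components of the relative Hilbert scheme of CURVES" in D. Arapura, *Hodge cycles and the Leray
  filtration* (2022), proof of Cor. 1.5, and C. Voisin, *Hodge Theory II* (2003), §3.3.1.

## References

* [EGAIV3] A. Grothendieck, J. Dieudonné, EGA IV₃, Publ. Math. IHÉS 28 (1966), Thm. 13.1.3,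
  Cor. 13.1.5.
* [Hartshorne1977] R. Hartshorne, Algebraic Geometry (1977), I Thm. 7.2, II Ex. 3.22.
* [Arapura2022] D. Arapura, Hodge cycles and the Leray filtration, Pacific J. Math. 319 (2022),
  proof of Cor. 1.5.
* [VoisinHodgeII2003] C. Voisin, Hodge Theory and Complex Algebraic Geometry II (CUP 2003), §3.3.1.
-/

noncomputable section

open CategoryTheory AlgebraicGeometry Limits Set Order
open _root_.Topology TopologicalSpace
open Literature.AlgebraicGeometry.Motives

attribute [local instance] MvPolynomial.gradedAlgebra

namespace Literature.AlgebraicGeometry.HodgeTheory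

section HodgeTheory

open MonoidalCategory CartesianMonoidalCategory

variable {𝒳 S T : Motives.SchemeOver ℂ} (f : 𝒳 ⟶ S) (hT : T ⟶ S) {N : ℕ}
  (ε : 𝒳 ⟶ projectiveSpace N ℂ)

/-- **The codimension condition on fibre supports is open, with an explicit open set.** Let
`f : 𝒳 ⟶ S` be proper, `S` and `T` locally of finite type over `ℂ`, `hT : T ⟶ S`, `ε : 𝒳 ⟶ ℙᴺ` a
preimmersion and `𝒵 ⊆ 𝒳 × T` closed with every slice inside its fibre. For `p n : ℕ` there is an
open `O ⊆ T` whose complex points are exactly the `y` such that every `x` with `(x, y) ∈ 𝒵` has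
`height x + p ≤ n`. (The construction inside the tree's `codim_dichotomy_of_isPreimmersion`:
`O = ⋃_F (image of 𝒵 ∩ {ε(x) ∈ V₊(F)})ᶜ` over `k`-tuples `F` of linear forms, `k = n + 1 - p`,
and the projective dimension theorem in the projective fibres.)
[cite: Hartshorne1977, I Thm. 7.2] [cite: EGAIV3, Cor. 13.1.5] -/
theorem exists_opens_pt_mem_iff_forall_height_add_le [IsProper f.left] [LocallyOfFiniteType S.hom]
    [LocallyOfFiniteType T.hom] [IsPreimmersion ε.left] {𝒵 : Set (𝒳 ⊗ T).left}
    (h𝒵 : IsClosed 𝒵)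
    (hgraph : ∀ (y : Motives.ComplexPoints T) (x : 𝒳.left), (sliceAt 𝒳 y).left.base x ∈ 𝒵 →
      f.left.base x = (AlgPoints.map hT y).pt)
    (p n : ℕ) :
    ∃ O : T.left.Opens, ∀ y : Motives.ComplexPoints T, y.pt ∈ (O : Set T.left) ↔
      ∀ x : 𝒳.left, (sliceAt 𝒳 y).left.base x ∈ 𝒵 → height x + p ≤ (n : ℕ∞) := by
  classical
  -- the proper projection `Φ : 𝒳 ×_S T → T` and the map `m : 𝒳 ×_S T → 𝒳 × T`
  let Φ : pullback f.left hT.left ⟶ T.left := pullback.snd f.left hT.left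
  let m : pullback f.left hT.left ⟶ (𝒳 ⊗ T).left :=
    pullback.lift (pullback.fst f.left hT.left) (pullback.snd f.left hT.left)
      (pullback_fst_comp_hom_eq f hT)
  have hm1 : m ≫ (CartesianMonoidalCategory.fst 𝒳 T).left = pullback.fst f.left hT.left :=
    pullback.lift_fst _ _ _
  have hm2 : m ≫ (CartesianMonoidalCategory.snd 𝒳 T).left = Φ := pullback.lift_snd _ _ _
  have hmfst : ∀ q, (CartesianMonoidalCategory.fst 𝒳 T).left.base (m.base q) =
      (pullback.fst f.left hT.left).base q := fun q => by
    change (m ≫ (CartesianMonoidalCategory.fst 𝒳 T).left).base q = _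
    rw [hm1]
  have hmsnd : ∀ q, (CartesianMonoidalCategory.snd 𝒳 T).left.base (m.base q) = Φ.base q :=
    fun q => by
    change (m ≫ (CartesianMonoidalCategory.snd 𝒳 T).left).base q = _
    rw [hm2]
  have hΦcl : IsClosedMap Φ.base := (pullback.snd f.left hT.left).isClosedMap
  -- the test sets: supports meeting `ε⁻¹ V₊(F)` for a tuple of forms `F`
  let k : ℕ := n + 1 - p
  let CF : (Fin k → MvPolynomial (Fin (N + 1)) ℂ) → Set (𝒳 ⊗ T).left := fun F =>
    {w | ∀ i,
      F i ∈ (ε.left.base ((CartesianMonoidalCategory.fst 𝒳 T).left.base w)).asHomogeneousIdeal}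
  have hCF : ∀ F, IsClosed (CF F) := fun F => by
    have h1 : CF F = ⋂ i, ((CartesianMonoidalCategory.fst 𝒳 T).left.base ⁻¹' (ε.left.base ⁻¹'
        (ProjectiveSpectrum.zeroLocus (MvPolynomial.homogeneousSubmodule (Fin (N + 1)) ℂ) {F i} :
          Set (projectiveSpace N ℂ).left))) := by
      ext w
      simp only [CF, Set.mem_setOf_eq, Set.mem_iInter, Set.mem_preimage]
      refine forall_congr' fun i => ?_
      exact (Set.singleton_subset_iff (a := F i)
        (s := ((ε.left.base ((CartesianMonoidalCategory.fst 𝒳 T).left.base w) : ProjectiveSpectrum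
          (MvPolynomial.homogeneousSubmodule (Fin (N + 1)) ℂ)).asHomogeneousIdeal :
            Set (MvPolynomial (Fin (N + 1)) ℂ)))).symm
    rw [h1]
    exact isClosed_iInter fun i => ((ProjectiveSpectrum.isClosed_zeroLocus _ _).preimage
      ε.left.continuous).preimage (CartesianMonoidalCategory.fst 𝒳 T).left.continuous
  let B : (Fin k → MvPolynomial (Fin (N + 1)) ℂ) → Set T.left := fun F =>
    Φ.base '' (m.base ⁻¹' (𝒵 ∩ CF F))
  have hB : ∀ F, IsClosed (B F) := fun F =>
    hΦcl _ ((h𝒵.inter (hCF F)).preimage m.continuous)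
  -- the open set
  let O : T.left.Opens :=
    ⟨⋃ F : {F : Fin k → MvPolynomial (Fin (N + 1)) ℂ //
        ∀ i, F i ∈ MvPolynomial.homogeneousSubmodule (Fin (N + 1)) ℂ 1}, (B F.1)ᶜ,
      isOpen_iUnion fun F => (hB F.1).isOpen_compl⟩
  -- pointwise description at a complex point `y` over `t`
  have key : ∀ y : Motives.ComplexPoints T, y.pt ∈ (O : Set T.left) ↔
      ∀ x : 𝒳.left, (sliceAt 𝒳 y).left.base x ∈ 𝒵 → height x + p ≤ (n : ℕ∞) := by
    intro y
    have hk : ∀ a : ℕ∞, a + p ≤ (n : ℕ∞) ↔ a < (k : ℕ∞) := fun a => height_add_le_iff_lt_sub a p n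
    -- the fibre over `t = hT(y)`, projective via `ι_t ≫ ε`
    haveI := isClosedImmersion_fiberι_comp_left f ε (AlgPoints.map hT y)
    haveI : IsProper (Motives.fiberOver f (AlgPoints.map hT y)).hom := isProper_fiberOver_hom f _
    -- the slice as a closed subset `Zy` of the fibre
    let Zy : Set (Motives.fiberOver f (AlgPoints.map hT y)).left :=
      {z | (sliceAt 𝒳 y).left.base ((Motives.fiberι f (AlgPoints.map hT y)).left.base z) ∈ 𝒵}
    have hZy : IsClosed Zy := h𝒵.preimage
      ((sliceAt 𝒳 y).left.continuous.comp (Motives.fiberι f (AlgPoints.map hT y)).left.continuous)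
    -- the section `q' : 𝒳_t → 𝒳 ×_S T`, `z ↦ (ι_t z, y)`
    let q' : (Motives.fiberOver f (AlgPoints.map hT y)).left ⟶ pullback f.left hT.left :=
      pullback.lift (Motives.fiberι f (AlgPoints.map hT y)).left
        (Motives.fiberOverToSpec f (AlgPoints.map hT y) ≫ y).left (fiberι_left_comp_eq f hT y)
    have hq'1 : q' ≫ pullback.fst f.left hT.left = (Motives.fiberι f (AlgPoints.map hT y)).left :=
      pullback.lift_fst _ _ _
    have hq'2 : q' ≫ Φ = (Motives.fiberOverToSpec f (AlgPoints.map hT y) ≫ y).left :=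
      pullback.lift_snd _ _ _
    have hq'm : ∀ z, m.base (q'.base z) =
        (sliceAt 𝒳 y).left.base ((Motives.fiberι f (AlgPoints.map hT y)).left.base z) := by
      intro z
      have h1 : q' ≫ m = (CartesianMonoidalCategory.lift (Motives.fiberι f (AlgPoints.map hT y))
          (Motives.fiberOverToSpec f (AlgPoints.map hT y) ≫ y)).left := by
        apply pullback.hom_ext
        · show (q' ≫ m) ≫ (CartesianMonoidalCategory.fst 𝒳 T).left =
            (CartesianMonoidalCategory.lift (Motives.fiberι f (AlgPoints.map hT y))
              (Motives.fiberOverToSpec f (AlgPoints.map hT y) ≫ y)).left ≫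
              (CartesianMonoidalCategory.fst 𝒳 T).left
          rw [Category.assoc, hm1, hq'1, ← Over.comp_left, CartesianMonoidalCategory.lift_fst]
        · show (q' ≫ m) ≫ (CartesianMonoidalCategory.snd 𝒳 T).left =
            (CartesianMonoidalCategory.lift (Motives.fiberι f (AlgPoints.map hT y))
              (Motives.fiberOverToSpec f (AlgPoints.map hT y) ≫ y)).left ≫
              (CartesianMonoidalCategory.snd 𝒳 T).left
          rw [Category.assoc, hm2, hq'2, ← Over.comp_left, CartesianMonoidalCategory.lift_snd]
      have h2 := congrArg (fun φ => φ.base z) h1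
      simp only [Scheme.Hom.comp_base, TopCat.coe_comp, Function.comp_apply] at h2
      rw [h2]
      exact lift_fiberι_base_apply f (AlgPoints.map hT y) y z
    have hq'Φ : ∀ z, Φ.base (q'.base z) = y.pt := by
      intro z
      have h2 := congrArg (fun φ => φ.base z) hq'2
      simp only [Scheme.Hom.comp_base, TopCat.coe_comp, Function.comp_apply, Over.comp_left] at h2
      rw [h2]
      haveI : Unique ↥(specOver ℂ ℂ).left := inferInstanceAs (Unique (PrimeSpectrum ℂ))
      rw [Subsingleton.elim ((Motives.fiberOverToSpec f (AlgPoints.map hT y)).left.base z)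
        (IsLocalRing.closedPoint ℂ)]
      rfl
    have hq'fst : ∀ z, (CartesianMonoidalCategory.fst 𝒳 T).left.base (m.base (q'.base z)) =
        (Motives.fiberι f (AlgPoints.map hT y)).left.base z := fun z => by
      rw [hmfst]
      change (q' ≫ pullback.fst f.left hT.left).base z = _
      rw [hq'1]
    -- `y ∉ B F` iff the slice misses `ε⁻¹ V₊(F)`
    have hBiff : ∀ F : Fin k → MvPolynomial (Fin (N + 1)) ℂ, y.pt ∉ B F ↔
        ∀ z ∈ Zy, ∃ i,
          F i ∉ ((Motives.fiberι f (AlgPoints.map hT y) ≫ ε).left.base z).asHomogeneousIdeal := by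
      intro F
      constructor
      · intro hyB z hz
        by_contra hall
        push Not at hall
        refine hyB ⟨q'.base z, ⟨?_, fun i => ?_⟩, hq'Φ z⟩
        · show m.base (q'.base z) ∈ 𝒵
          rw [hq'm]
          exact hz
        · rw [hq'fst]
          exact hall i
      · rintro hZ ⟨q, ⟨hq𝒵, hqC⟩, hqy⟩
        obtain ⟨x, hx⟩ := exists_sliceAt_base_eq y (m.base q) (by rw [hmsnd]; exact hqy)
        have hx𝒵 : (sliceAt 𝒳 y).left.base x ∈ 𝒵 := by
          rw [hx]
          exact hq𝒵
        obtain ⟨z, rfl⟩ := exists_fiberι_base_eq f (AlgPoints.map hT y) x (hgraph y x hx𝒵)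
        obtain ⟨i, hi⟩ := hZ z hx𝒵
        apply hi
        have hfst : (CartesianMonoidalCategory.fst 𝒳 T).left.base (m.base q) =
            (Motives.fiberι f (AlgPoints.map hT y)).left.base z := by
          rw [← hx]
          change (sliceAt 𝒳 y ≫ CartesianMonoidalCategory.fst 𝒳 T).left.base _ = _
          rw [sliceAt_fst]
          rfl
        have h := hqC i
        rw [hfst] at h
        exact h
    -- assemble with the projective dimension theorem in the fibre
    have hmemO : y.pt ∈ (O : Set T.left) ↔
        ∃ F : {F : Fin k → MvPolynomial (Fin (N + 1)) ℂ //
          ∀ i, F i ∈ MvPolynomial.homogeneousSubmodule (Fin (N + 1)) ℂ 1}, y.pt ∉ B F.1 := by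
      change y.pt ∈ ⋃ F : {F : Fin k → MvPolynomial (Fin (N + 1)) ℂ //
        ∀ i, F i ∈ MvPolynomial.homogeneousSubmodule (Fin (N + 1)) ℂ 1}, (B F.1)ᶜ ↔ _
      simp only [Set.mem_iUnion, Set.mem_compl_iff]
    rw [hmemO]
    constructor
    · rintro ⟨F, hF⟩ x hx
      rw [hk]
      obtain ⟨z, rfl⟩ := exists_fiberι_base_eq f (AlgPoints.map hT y) x (hgraph y x hx)
      rw [height_fiberι_base_eq f (AlgPoints.map hT y) z]
      exact (forall_height_lt_iff_exists_forms (Motives.fiberι f (AlgPoints.map hT y) ≫ ε) hZy).2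
        ⟨F.1, F.2, (hBiff F.1).1 hF⟩ z hx
    · intro hgood
      have hZlt : ∀ z ∈ Zy, height z < (k : ℕ∞) := fun z hz => by
        rw [← height_fiberι_base_eq f (AlgPoints.map hT y) z, ← hk]
        exact hgood _ hz
      obtain ⟨F, hF, hFZ⟩ :=
        (forall_height_lt_iff_exists_forms (Motives.fiberι f (AlgPoints.map hT y) ≫ ε) hZy).1 hZlt
      exact ⟨⟨F, hF⟩, (hBiff F).2 hFZ⟩
  exact ⟨O, key⟩

/-- **Chevalley's semicontinuity, closed form: the parameters whose fibre support violates the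
codimension condition form a Zariski-closed subset.** In the setting of
`exists_opens_pt_mem_iff_forall_height_add_le` there is a closed `C ⊆ T` whose complex points are
exactly the `y` for which SOME `x` with `(x, y) ∈ 𝒵` has `n < height x + p`.
[cite: EGAIV3, Cor. 13.1.5] [cite: Hartshorne1977, II Ex. 3.22] -/
theorem exists_isClosed_pt_mem_iff_exists_lt_height_add [IsProper f.left] [LocallyOfFiniteType S.hom]
    [LocallyOfFiniteType T.hom] [IsPreimmersion ε.left] {𝒵 : Set (𝒳 ⊗ T).left}
    (h𝒵 : IsClosed 𝒵)
    (hgraph : ∀ (y : Motives.ComplexPoints T) (x : 𝒳.left), (sliceAt 𝒳 y).left.base x ∈ 𝒵 →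
      f.left.base x = (AlgPoints.map hT y).pt)
    (p n : ℕ) :
    ∃ C : Set T.left, IsClosed C ∧ ∀ y : Motives.ComplexPoints T, y.pt ∈ C ↔
      ∃ x : 𝒳.left, (sliceAt 𝒳 y).left.base x ∈ 𝒵 ∧ (n : ℕ∞) < height x + p := by
  obtain ⟨O, hO⟩ := exists_opens_pt_mem_iff_forall_height_add_le f hT ε h𝒵 hgraph p n
  refine ⟨(O : Set T.left)ᶜ, O.isOpen.isClosed_compl, fun y => ?_⟩
  rw [Set.mem_compl_iff, hO y]
  push Not
  rfl

/-- **The positive-dimension locus is closed** (`p = n` in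
`exists_isClosed_pt_mem_iff_exists_lt_height_add`): there is a closed `C ⊆ T` whose complex points
are exactly the parameters `y` whose support `𝒵_y` contains a point `x` of POSITIVE height
(`height x ≠ 0`, i.e. a non-closed point: `dim 𝒵_y ≥ 1`) — on the hyperplane witness families, the
parameters of tuples of hypersurfaces cutting the fibre in a set of dimension `≥ 1`, the tree's
stand-in for the relative Hilbert scheme of curves in the fibres.
[cite: Arapura2022, proof of Cor. 1.5] [cite: VoisinHodgeII2003, §3.3.1] [cite: EGAIV3, Cor. 13.1.5] -/
theorem exists_isClosed_pt_mem_iff_exists_height_ne_zero [IsProper f.left] [LocallyOfFiniteType S.hom]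
    [LocallyOfFiniteType T.hom] [IsPreimmersion ε.left] {𝒵 : Set (𝒳 ⊗ T).left}
    (h𝒵 : IsClosed 𝒵)
    (hgraph : ∀ (y : Motives.ComplexPoints T) (x : 𝒳.left), (sliceAt 𝒳 y).left.base x ∈ 𝒵 →
      f.left.base x = (AlgPoints.map hT y).pt)
    (n : ℕ) :
    ∃ C : Set T.left, IsClosed C ∧ ∀ y : Motives.ComplexPoints T, y.pt ∈ C ↔
      ∃ x : 𝒳.left, (sliceAt 𝒳 y).left.base x ∈ 𝒵 ∧ height x ≠ 0 := by
  obtain ⟨C, hC, hiff⟩ := exists_isClosed_pt_mem_iff_exists_lt_height_add f hT ε h𝒵 hgraph n n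
  refine ⟨C, hC, fun y => ?_⟩
  rw [hiff y]
  refine exists_congr fun x => and_congr_right fun _ => ?_
  have hn : (n : ℕ∞) ≠ ⊤ := ENat.coe_ne_top n
  constructor
  · intro h h0
    rw [h0, zero_add] at h
    exact lt_irrefl _ h
  · intro h
    have hpos : 0 < height x := pos_iff_ne_zero.2 h
    calc (n : ℕ∞) = 0 + n := (zero_add _).symm
      _ < height x + n := (ENat.add_lt_add_iff_right hn).2 hpos

end HodgeTheory

end Literature.AlgebraicGeometry.HodgeTheory

end
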